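import Mathlib.Algebra.MvPolynomial.PDeriv
import Mathlib.RingTheory.Ideal.Quotient.Operations
import Mathlib.RingTheory.Ideal.Maps
import Mathlib.RingTheory.Polynomial.Quotient
import Mathlib.Tactic.LinearCombination
import HarnessLib

/-!
# `EquisingularLiftNat` — helpers: four local-algebra hinges of idea cards 4 and 5 along a section
# (`SingularPointSpecialises`, `MultiplicitySemicontinuous`, `RamifiedWindow`, `RigidTraceBaseInsensitive` — VERBATIM)

[OURS · L1 W4.5(b)] Support lemmas for the crux `EquisingularLiftNat` (stmt-ResolutionOfSingularities-20038;
`Summit.ResolutionOfSingularities.ResolutionOfSingularities.Theses.EquisingularLift.EquisingularLiftNat`): the hinges (a), (b)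
of idea card 4 `equigeneric-foresee` and steps (a), (b) of idea card 5 `ramified-window` of res-L1-w45b-idea-2 (round 3;
Sketch `HOME/L/res-L1-w45b-idea-2/Sketch-L1-idea-2.lean` v5, ll. 186, 200, 233, 247 — there with `sorry`), proved VERBATIM so that the
cards can cite them by name (same service as res-L1-w45b-idea-2's ASK ×3 (B) of 2026-08-27T06:26:09Z for cards 7/8). NOT
statements of any manuscript under review; AI-written kernel lemmas of the cell `res-hironaka` (weaker than expert review).
Typed by res-type-018. No definition is declared.

* `singularPointSpecialises` — a singular `O`-point of `V(f)` (value and all partials vanish) reduces, modulo any ideal `I`,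
  to a singular point of the reduced equation (`MvPolynomial.eval_map`, `eval₂_comp`, `pderiv_map`).
* `multiplicitySemicontinuous` — membership of `f` in the `m`-th power of the SECTION ideal `(Xᵢ − aᵢ)ᵢ` survives reduction
  modulo `I` (`Ideal.mem_map_of_mem`, `Ideal.map_pow`, `Ideal.map_span`): `mult_{a_K} f_K ≤ mult_{ā} f̄` in the card's reading.
* `ramifiedWindow` — the equicharacteristic window of a ramified base: `O[X]/(X^e − ϖ, X^m) ≅ (O/ϖ)[X]/(X^m)` for
  `1 ≤ m ≤ e` (`(X^e − ϖ, X^m) = (ϖ, X^m)` since `X^e ∈ (X^m)`; then `DoubleQuot.quotQuotEquivQuotSup` and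
  `Ideal.polynomialQuotientEquivQuotientPolynomial`).
* `rigidTraceBaseInsensitive` — for a FAITHFUL `O`-algebra `O′` (injective structure map), `O/I` has an `O`-algebra point in
  `O′` iff `I = 0`: choosing a ramified base buys nothing for rigid traces.

References: folklore commutative algebra. Kernel-only (propext, Classical.choice, Quot.sound).
-/

-- single-problem summit: the doubled namespace component `ResolutionOfSingularities` is forced
set_option linter.dupNamespace false

namespace Summit.ResolutionOfSingularities.ResolutionOfSingularities.Theorems.EquisingularLift.SectionHinges

/-- **Card 4, hinge (a): singular points of the generic fibre specialise to singular points of the special fibre along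
sections — VERBATIM `SingularPointSpecialises`.** If `f(a) = 0` and `∂ᵢf(a) = 0` for all `i`, then the reduction `f̄` of `f`
modulo `I` and all its partials vanish at the reduced point `ā`. [Evaluation and partial derivatives commute with the
coefficient map `O → O/I`.] [folklore; OURS for idea card 4 `equigeneric-foresee` of res-L1-w45b-idea-2] -/
theorem singularPointSpecialises :
    ∀ (O : Type) [CommRing O] (I : Ideal O) (n : ℕ) (f : MvPolynomial (Fin n) O) (a : Fin n → O),
    MvPolynomial.eval a f = 0 → (∀ i, MvPolynomial.eval a (MvPolynomial.pderiv i f) = 0) →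
    MvPolynomial.eval (fun i => Ideal.Quotient.mk I (a i)) (MvPolynomial.map (Ideal.Quotient.mk I) f) = 0 ∧
    ∀ i, MvPolynomial.eval (fun i => Ideal.Quotient.mk I (a i))
      (MvPolynomial.pderiv i (MvPolynomial.map (Ideal.Quotient.mk I) f)) = 0 := by
  intro O _ I n f a hf hdf
  -- evaluation at the reduced point of the reduced polynomial = reduction of the evaluation
  have key : ∀ g : MvPolynomial (Fin n) O,
      MvPolynomial.eval (fun i => Ideal.Quotient.mk I (a i)) (MvPolynomial.map (Ideal.Quotient.mk I) g) =
        Ideal.Quotient.mk I (MvPolynomial.eval a g) := fun g => by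
    rw [MvPolynomial.eval_map, MvPolynomial.eval₂_comp]
    rfl
  refine ⟨by rw [key, hf, map_zero], fun i => ?_⟩
  rw [MvPolynomial.pderiv_map, key, hdf i, map_zero]

/-- **Card 4, hinge (b): multiplicity is upper semicontinuous along a section — VERBATIM `MultiplicitySemicontinuous`.**
If `f` lies in the `m`-th power of the section ideal `(X₁ − a₁, …, X_n − a_n)` of `O[X]`, then its reduction `f̄` modulo `I`
lies in the `m`-th power of the reduced section ideal `(X₁ − ā₁, …, X_n − ā_n)` of `(O/I)[X]` (`mult_{a_K}(f_K) ≤ mult_{ā}(f̄)`).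
[The coefficient map sends the section ideal onto the reduced section ideal; images of powers are powers of images.]
[folklore; OURS for idea card 4 `equigeneric-foresee` of res-L1-w45b-idea-2] -/
theorem multiplicitySemicontinuous :
    ∀ (O : Type) [CommRing O] (I : Ideal O) (n m : ℕ) (f : MvPolynomial (Fin n) O) (a : Fin n → O),
    f ∈ (Ideal.span (Set.range fun i => (MvPolynomial.X i - MvPolynomial.C (a i) : MvPolynomial (Fin n) O))) ^ m →
    MvPolynomial.map (Ideal.Quotient.mk I) f ∈
      (Ideal.span (Set.range fun i =>
        (MvPolynomial.X i - MvPolynomial.C (Ideal.Quotient.mk I (a i)) : MvPolynomial (Fin n) (O ⧸ I)))) ^ m := by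
  intro O _ I n m f a hf
  have h := Ideal.mem_map_of_mem (MvPolynomial.map (Ideal.Quotient.mk I)) hf
  rw [Ideal.map_pow, Ideal.map_span, ← Set.range_comp] at h
  have hset : (⇑(MvPolynomial.map (Ideal.Quotient.mk I)) ∘ fun i =>
        (MvPolynomial.X i - MvPolynomial.C (a i) : MvPolynomial (Fin n) O)) =
      fun i => (MvPolynomial.X i - MvPolynomial.C (Ideal.Quotient.mk I (a i)) : MvPolynomial (Fin n) (O ⧸ I)) := by
    funext i
    simp only [Function.comp_apply, map_sub, MvPolynomial.map_X, MvPolynomial.map_C]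
  rwa [hset] at h

open Polynomial in
/-- **Card 5, step (a): the equicharacteristic window of a ramified base — VERBATIM `RamifiedWindow`.** For any `ϖ ∈ O`
and `1 ≤ m ≤ e`: `O[X]/(X^e − ϖ, X^m) ≅ (O/ϖ)[X]/(X^m)`. Read with `O = W(k)`, `ϖ = p·(unit)`: the truncations `O′/ϖ′^m`,
`m ≤ e`, of a totally ramified extension of index `e` are the EQUICHARACTERISTIC jet rings `k[ε]/ε^m`. [`X^e = X^{e−m}·X^m`,
so `(X^e − ϖ, X^m) = (ϖ, X^m)`; then `O[X]/((ϖ) + (X^m)) ≅ (O[X]/(ϖ))/(X^m) ≅ (O/ϖ)[X]/(X^m)`. The hypothesis `1 ≤ m`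
is not used.] [folklore; OURS for idea card 5 `ramified-window` of res-L1-w45b-idea-2] -/
theorem ramifiedWindow :
    ∀ (O : Type) [CommRing O] (ϖ : O) (e m : ℕ), 1 ≤ m → m ≤ e →
    Nonempty ((Polynomial O ⧸ (Ideal.span {(Polynomial.X ^ e - Polynomial.C ϖ : Polynomial O), Polynomial.X ^ m}))
      ≃+* (Polynomial (O ⧸ (Ideal.span {ϖ} : Ideal O)) ⧸
            (Ideal.span {(Polynomial.X ^ m : Polynomial (O ⧸ (Ideal.span {ϖ} : Ideal O)))}))) := by
  intro O _ ϖ e m _h1 hme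
  set P : Ideal O[X] := Ideal.map (Polynomial.C : O →+* O[X]) (Ideal.span {ϖ}) with hP
  have hem : (X : O[X]) ^ (e - m) * X ^ m = X ^ e := by rw [← pow_add, Nat.sub_add_cancel hme]
  -- (1) `(X^e − ϖ, X^m) = (ϖ) + (X^m)` in `O[X]`
  have hJ : Ideal.span {(X ^ e - C ϖ : O[X]), X ^ m} = P ⊔ Ideal.span {X ^ m} := by
    have hPe : P = Ideal.span {C ϖ} := by rw [hP, Ideal.map_span, Set.image_singleton]
    rw [hPe, ← Ideal.span_insert]
    apply le_antisymm
    · rw [Ideal.span_le]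
      rintro x hx
      rcases hx with rfl | rfl
      · exact Ideal.mem_span_pair.mpr ⟨-1, X ^ (e - m), by linear_combination hem⟩
      · exact Ideal.subset_span (Or.inr rfl)
    · rw [Ideal.span_le]
      rintro x hx
      rcases hx with rfl | rfl
      · exact Ideal.mem_span_pair.mpr ⟨-1, X ^ (e - m), by linear_combination hem⟩
      · exact Ideal.subset_span (Or.inr rfl)
  -- (2) `O[X]/((ϖ) + (X^m)) ≅ (O[X]/(ϖ))/(X^m) ≅ (O/ϖ)[X]/(X^m)`
  let f : (O[X] ⧸ P) ≃+* (O ⧸ Ideal.span {ϖ})[X] :=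
    (Ideal.polynomialQuotientEquivQuotientPolynomial (Ideal.span {ϖ})).symm
  have hf : Ideal.span {(X ^ m : (O ⧸ Ideal.span {ϖ})[X])} =
      ((Ideal.span {(X ^ m : O[X])}).map (Ideal.Quotient.mk P)).map (f : (O[X] ⧸ P) →+* (O ⧸ Ideal.span {ϖ})[X]) := by
    rw [Ideal.map_span, Set.image_singleton, Ideal.map_span, Set.image_singleton, RingHom.coe_coe]
    congr 2
    change X ^ m = (Ideal.polynomialQuotientEquivQuotientPolynomial (Ideal.span {ϖ})).symm
      (Ideal.Quotient.mk _ (X ^ m))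
    rw [Ideal.polynomialQuotientEquivQuotientPolynomial_symm_mk, Polynomial.map_pow, Polynomial.map_X]
  exact ⟨(Ideal.quotEquivOfEq hJ).trans <|
    (DoubleQuot.quotQuotEquivQuotSup P (Ideal.span {X ^ m})).symm.trans <|
      Ideal.quotientEquiv _ _ f hf⟩

/-- **Card 5, step (b): rigid traces are base-insensitive — VERBATIM `RigidTraceBaseInsensitive`.** For a faithful
`O`-algebra `O′` (injective structure map) and an ideal `I ⊆ O`: there is an `O`-algebra map `O/I → O′` iff `I = 0`.
[`→`: an `O`-algebra map sends `x̄ = 0` (`x ∈ I`) to `algebraMap x`, which is then `0`, so `x = 0` by faithfulness;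
`←`: `O/0 → O′` is the structure map.] Read: if the deformation hull of the trace is a quotient `O/I` of the base, it has a
point over SOME faithful `O′` iff it already lifts over `O`. [folklore; OURS for idea card 5 `ramified-window` of
res-L1-w45b-idea-2] -/
theorem rigidTraceBaseInsensitive :
    ∀ (O O' : Type) [CommRing O] [CommRing O'] [Algebra O O'], Function.Injective (algebraMap O O') →
    ∀ I : Ideal O, Nonempty ((O ⧸ I) →ₐ[O] O') ↔ I = ⊥ := by
  intro O O' _ _ _ hinj I
  constructor
  · rintro ⟨φ⟩
    refine le_bot_iff.mp fun x hx => ?_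
    rw [Ideal.mem_bot]
    apply hinj
    rw [map_zero, ← φ.commutes x, Ideal.Quotient.algebraMap_eq, Ideal.Quotient.eq_zero_iff_mem.mpr hx, map_zero]
  · rintro rfl
    exact ⟨Ideal.Quotient.liftₐ ⊥ (Algebra.ofId O O') fun a ha => by
      rw [Ideal.mem_bot] at ha
      rw [ha, map_zero]⟩

end Summit.ResolutionOfSingularities.ResolutionOfSingularities.Theorems.EquisingularLift.SectionHinges
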